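import Summits.ValiantsHypothesis.ValiantsHypothesis.Theses.FeketeSOS

/-!
# `FeketeSOS.CharPSparseSOS` (stmt-ValiantsHypothesis-14989) — negative side: the exponent coupling caps `δ` at `1/2`

Standing disprover (cdisprove, cycle 1), from `Cruxes/CharPSparseSOS/Disproof.lean` §(b).
In the crux the SAME `δ` bounds the number of squares (`s ≤ p^δ`) and the gain (`Σ #supp g_i ≥ p^{1/2+δ}`).  For every
`δ > 1/2` the body is false: over `ZMod p` the trivial representation `F̄_p = (½(F̄_p+1))² − (½(F̄_p−1))²` has `s = 2 ≤ p^δ`,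
degree `< p` and support-sum `≤ 2p < p^{1/2+δ}` for `p > 2^{1/(δ−1/2)}`.  So an admissible `δ` lies in `(0, 1/2]` (any `δ < 1/2`
is consistent with the landed one-product bound `(p+3)/2`), the analogue of `FeketeNoSparseSplit.Negative.ExponentHalf`.
Elementary; no facts; the refuted statement is the crux's inner block verbatim with `δ` fixed. [folklore]
-/

set_option linter.dupNamespace false

namespace Summit.ValiantsHypothesis.ValiantsHypothesis.Theorems.CharPSparseSOS.Negative

noncomputable section

section Boundary

open Polynomial Finset

/-- `#supp (C a * (F + C b)) ≤ p` for `deg F < p`. -/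
theorem card_support_affine_le {K : Type} [Field K] (p : ℕ) (F : K[X]) (hF : F.natDegree < p) (a b : K) :
    (C a * (F + C b)).support.card ≤ p := by
  refine (card_supp_le_succ_natDegree _).trans ?_
  have h1 : (C a * (F + C b)).natDegree ≤ F.natDegree := by
    refine (natDegree_C_mul_le _ _).trans ((natDegree_add_le _ _).trans ?_)
    rw [natDegree_C]; exact max_le le_rfl (Nat.zero_le _)
  omega

/-- **The exponent coupling caps `δ` at `1/2`.**  In `CharPSparseSOS` the SAME `δ` bounds the number of squares
(`s ≤ p^δ`) and the gain (`Σ #supp ≥ p^{1/2+δ}`); the body is false for every `δ > 1/2`, by the trivial two-square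
representation `F̄_p = (½(F̄_p+1))² − (½(F̄_p−1))²` of support-sum `≤ 2p < p^{1/2+δ}` (`s = 2 ≤ p^δ`).  So an admissible
`δ` lies in `(0, 1/2]`; together with the landed one-product bound `(p+3)/2` (any `δ < 1/2` works at `s ≤ 2`) this pins
the true range of the crux's exponent to `(0, 1/2)` ∪ possibly `{1/2}`, exactly as `FeketeNoSparseSplit.Negative.ExponentHalf`
does for splittings. [folklore] -/
theorem charPSparseSOS_exponent_boundary (δ : ℝ) (hδ : 1 / 2 < δ) :
    ¬ (∃ p₀ : ℕ, ∀ (p : ℕ) [Fact p.Prime], p₀ ≤ p → ∀ (K : Type) [Field K] [CharP K p] (s : ℕ) (c : Fin s → K)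
        (g : Fin s → K[X]), (s : ℝ) ≤ (p : ℝ) ^ δ → (∀ i, (g i).natDegree < p) →
        ((X : K[X]) ^ p - 1 ∣ (∑ i, C (c i) * g i ^ 2) - ∑ m ∈ range p, C ((legendreSym p m : ℤ) : K) * X ^ m) →
        (p : ℝ) ^ (1 / 2 + δ) ≤ ∑ i, ((g i).support.card : ℝ)) := by
  rintro ⟨p₀, h⟩
  have hη : 0 < δ - 1 / 2 := by linarith
  obtain ⟨p, hp, hpprime⟩ := Nat.exists_infinite_primes (max (max p₀ (⌈(2 : ℝ) ^ (1 / (δ - 1 / 2))⌉₊ + 1)) 5)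
  haveI : Fact p.Prime := ⟨hpprime⟩
  have hp5 : 5 ≤ p := le_of_max_le_right hp
  have h2 : (2 : ZMod p) ≠ 0 := by
    intro h0
    have h' : ((2 : ℕ) : ZMod p) = 0 := by exact_mod_cast h0
    rw [ZMod.natCast_eq_zero_iff] at h'
    have := Nat.le_of_dvd (by norm_num) h'
    omega
  set F : (ZMod p)[X] := ∑ m ∈ range p, C ((legendreSym p m : ℤ) : ZMod p) * X ^ m with hF
  have hFdeg : F.natDegree < p := by
    have hle : F.natDegree ≤ p - 1 := by
      rw [hF]
      refine natDegree_sum_le_of_forall_le _ _ fun m hm => (natDegree_C_mul_X_pow_le _ _).trans ?_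
      have := mem_range.mp hm; omega
    omega
  -- the witness: s = 2, c = (1, -1), g = (½(F+1), ½(F-1))
  have key := h p (le_of_max_le_left (le_of_max_le_left hp)) (ZMod p) 2 ![1, -1]
    ![C (1 / 2 : ZMod p) * (F + C 1), C (1 / 2 : ZMod p) * (F + C (-1))]
  have hid : (∑ i, C ((![1, -1] : Fin 2 → ZMod p) i) *
      (![C (1 / 2 : ZMod p) * (F + C 1), C (1 / 2 : ZMod p) * (F + C (-1))] i) ^ 2) = F := by
    simp only [Fin.sum_univ_two, Matrix.cons_val_zero, Matrix.cons_val_one]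
    have hh : C (1 / 2 : ZMod p) * C (1 / 2 : ZMod p) * 4 = 1 := by
      rw [show (4 : (ZMod p)[X]) = C 4 from (map_ofNat C 4).symm, ← C_mul, ← C_mul, ← C_1]
      congr 1
      rw [show (4 : ZMod p) = 2 * 2 by norm_num]
      field_simp
    simp only [map_one, map_neg]
    linear_combination F * hh
  have hdeg : ∀ i, ((![C (1 / 2 : ZMod p) * (F + C 1), C (1 / 2 : ZMod p) * (F + C (-1))] :
      Fin 2 → (ZMod p)[X]) i).natDegree < p := by
    intro i
    fin_cases i
    · show (C (1 / 2 : ZMod p) * (F + C 1)).natDegree < p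
      refine lt_of_le_of_lt ((natDegree_C_mul_le _ _).trans ((natDegree_add_le _ _).trans ?_)) hFdeg
      rw [natDegree_C]; exact max_le le_rfl (Nat.zero_le _)
    · show (C (1 / 2 : ZMod p) * (F + C (-1))).natDegree < p
      refine lt_of_le_of_lt ((natDegree_C_mul_le _ _).trans ((natDegree_add_le _ _).trans ?_)) hFdeg
      rw [natDegree_C]; exact max_le le_rfl (Nat.zero_le _)
  have hdvd : ((X : (ZMod p)[X]) ^ p - 1 ∣ (∑ i, C ((![1, -1] : Fin 2 → ZMod p) i) *
      (![C (1 / 2 : ZMod p) * (F + C 1), C (1 / 2 : ZMod p) * (F + C (-1))] i) ^ 2) - F) := by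
    rw [hid, sub_self]; exact dvd_zero _
  -- reals
  have hp1 : (1 : ℝ) < (p : ℝ) := by exact_mod_cast (show 1 < p by omega)
  have hp0 : (0 : ℝ) < (p : ℝ) := by linarith
  have hceil : (2 : ℝ) ^ (1 / (δ - 1 / 2)) < (p : ℝ) := by
    have h1 : ((⌈(2 : ℝ) ^ (1 / (δ - 1 / 2))⌉₊ + 1 : ℕ) : ℝ) ≤ (p : ℝ) := by
      exact_mod_cast le_of_max_le_right (le_of_max_le_left hp)
    push_cast at h1
    linarith [Nat.le_ceil ((2 : ℝ) ^ (1 / (δ - 1 / 2)))]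
  have hpη : (2 : ℝ) < (p : ℝ) ^ (δ - 1 / 2) := by
    have : ((2 : ℝ) ^ (1 / (δ - 1 / 2))) ^ (δ - 1 / 2) < (p : ℝ) ^ (δ - 1 / 2) :=
      Real.rpow_lt_rpow (by positivity) hceil hη
    rwa [← Real.rpow_mul (by norm_num), one_div_mul_cancel hη.ne', Real.rpow_one] at this
  have hs : ((2 : ℕ) : ℝ) ≤ (p : ℝ) ^ δ := by
    have h1 : (p : ℝ) ^ (δ - 1 / 2) ≤ (p : ℝ) ^ δ := Real.rpow_le_rpow_of_exponent_le hp1.le (by linarith)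
    push_cast; linarith
  have hbound := key hs hdeg hdvd
  have hS : (∑ i, (((![C (1 / 2 : ZMod p) * (F + C 1), C (1 / 2 : ZMod p) * (F + C (-1))] :
      Fin 2 → (ZMod p)[X]) i).support.card : ℝ)) ≤ 2 * (p : ℝ) := by
    simp only [Fin.sum_univ_two, Matrix.cons_val_zero, Matrix.cons_val_one]
    have e1 : ((C (1 / 2 : ZMod p) * (F + C 1)).support.card : ℝ) ≤ p := by
      exact_mod_cast card_support_affine_le p F hFdeg _ _
    have e2 : ((C (1 / 2 : ZMod p) * (F + C (-1))).support.card : ℝ) ≤ p := by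
      exact_mod_cast card_support_affine_le p F hFdeg _ _
    linarith
  have hsplit : (p : ℝ) ^ (1 / 2 + δ) = (p : ℝ) * (p : ℝ) ^ (δ - 1 / 2) := by
    rw [show (1 / 2 + δ : ℝ) = 1 + (δ - 1 / 2) by ring, Real.rpow_add hp0, Real.rpow_one]
  rw [hsplit] at hbound
  have : 2 * (p : ℝ) < (p : ℝ) * (p : ℝ) ^ (δ - 1 / 2) := by nlinarith
  linarith

end Boundary

end

end Summit.ValiantsHypothesis.ValiantsHypothesis.Theorems.CharPSparseSOS.Negative
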